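import Mathlib
import HarnessLib
import Literature.NumberTheory.Sieve.BatemanHornProofs
import Summits.Parity.BatemanHorn.Theses.AlmostPrimeZeros
import Summits.Parity.BatemanHorn.Theorems.AlmostPrimeZerosExtractionAtZeroAux

/-!
# Route AlmostPrimeZeros — item `ExtractionAtZero` (stmt-Parity-11330): extraction at the `k`-fold zero

For a Bateman–Horn system `f = (f_1, …, f_k)`, `Λ` holomorphic on `|z| < 2` with `Λ(0) = C(f)`,
and convergence `H_x^{(k)}(0) → Ψ^{(k)}(0)` of the `k`-th derivatives at `0` of the normalised
almost-prime family `H_x(z) = x⁻¹ e^{k(1−z) log log x} Σ_{n ≤ x} z^{s_f(n)}` (capped statistic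
`s_f(n) = Σ_i Σ_{p^v ∥ f_i(n)} min(v,2)`) to those of `Ψ(z) = Λ(z) D^{z−1} Γ(z)^{−k}`
(`D = ∏ deg f_i`), we get the Bateman–Horn asymptotic `π_f(x) ~ (C(f)/D) x/(log x)^k`.

* `Ψ^{(k)}(0) = k!·Λ(0)/D` since `Γ(z)⁻¹ = z·Γ(z+1)⁻¹` (`iteratedDeriv_limitFunction_apply_zero`);
* `H_x^{(k)}(0) = x⁻¹(log x)^k Σ_{n ≤ x} T(s_f(n))`, `T(m) = [m ≤ k] C(k,m) m! (−k log log x)^{k−m}`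
  (Leibniz, `iteratedDeriv_normalisedFamily_apply_zero`);
* for `n ≥ n₀(f)` all `f_i(n) ≥ 2`, so `s_f(n) ≥ k` with equality iff all `f_i(n)` are prime
  (`capped_stat_of_two_le`): the main term is `k!·c_k(x)` with `|c_k(x) − π_f(x)| ≤ n₀` and the
  remainder is `O((log log x)^k)`;
* hence `x⁻¹(log x)^k π_f(x) → C(f)/D > 0` (`IsBatemanHornSystem.hasBatemanHornConst_holds`).
-/

open Filter Finset Polynomial Topology Complex

namespace Summit.Parity.BatemanHorn.Theorems.AlmostPrimeZerosExtraction

/-- **Item stmt-Parity-11330 (`ExtractionAtZero`, route AlmostPrimeZeros): extraction at the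
`k`-fold zero.** For a Bateman–Horn system `f`, `Λ` holomorphic on `|z| < 2` with `Λ(0) = C(f)`, and
`H_x^{(k)}(0) → Ψ^{(k)}(0)`, the Bateman–Horn asymptotic for `f` follows: `Ψ^{(k)}(0) = k!·C(f)/D`
(`Γ(z)⁻¹ = zΓ(z+1)⁻¹`), `H_x^{(k)}(0) = x⁻¹(log x)^k (k!·c_k(x) + O_f((log log x)^k))` with
`|c_k(x) − π_f(x)| ≤ n₀` (the capped statistic is `k` exactly at simultaneous prime values once all
`fᵢ(n) ≥ 2`), whence `x⁻¹(log x)^k π_f(x) → C(f)/D`, i.e. `π_f(x) ~ (C(f)/D)·x/(log x)^k` since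
`C(f) > 0` (`IsBatemanHornSystem.hasBatemanHornConst_holds`). -/
theorem extractionAtZero_proof :
    Summit.Parity.BatemanHorn.Theses.AlmostPrimeZeros.ExtractionAtZero := by
  unfold Summit.Parity.BatemanHorn.Theses.AlmostPrimeZeros.ExtractionAtZero
  intro k f hf Λ hΛ hΛ0 hT
  -- constants of the system
  obtain ⟨hC, hCpos⟩ :=
    Literature.NumberTheory.Sieve.IsBatemanHornSystem.hasBatemanHornConst_holds hf
  have hDpos : 0 < ∏ i, ((f i).natDegree : ℝ) :=
    Finset.prod_pos fun i _ => by exact_mod_cast hf.natDegree_pos i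
  -- the capped statistic, named
  obtain ⟨e, he⟩ : ∃ e : ℕ → ℕ,
      ∀ n, e n = ∑ i, (((f i).eval (n : ℤ)).toNat.factorization.sum fun _ v => min v 2) :=
    ⟨_, fun n => rfl⟩
  simp only [← he] at hT
  -- eventual behaviour of the statistic
  obtain ⟨n₀, hn₀⟩ := exists_forall_two_le_eval hf
  have hge : ∀ n, n₀ ≤ n → k ≤ e n := fun n hn => by
    rw [he]; exact (capped_stat_of_two_le (hn₀ n hn)).1
  have himp1 : ∀ n, n₀ ≤ n → e n = k →
      ∀ i, 0 < (f i).eval (n : ℤ) ∧ ((f i).eval (n : ℤ)).toNat.Prime := fun n hn h => by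
    rw [he] at h; exact (capped_stat_of_two_le (hn₀ n hn)).2.mp h
  have himp2 : ∀ n, n₀ ≤ n →
      (∀ i, 0 < (f i).eval (n : ℤ) ∧ ((f i).eval (n : ℤ)).toNat.Prime) → e n = k :=
      fun n hn h => by
    rw [he]; exact (capped_stat_of_two_le (hn₀ n hn)).2.mpr h
  have hcp : ∀ x : ℕ, ((((Finset.range (x + 1)).filter fun n => e n = k).card : ℕ) : ℝ) ≤
      n₀ + (Literature.NumberTheory.Sieve.polyPrimeCount f x : ℝ) := fun x => by
    unfold Literature.NumberTheory.Sieve.polyPrimeCount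
    exact_mod_cast card_filter_le_add_card_filter himp1 (Finset.range (x + 1))
  have hpc : ∀ x : ℕ, (Literature.NumberTheory.Sieve.polyPrimeCount f x : ℝ) ≤
      n₀ + ((((Finset.range (x + 1)).filter fun n => e n = k).card : ℕ) : ℝ) := fun x => by
    unfold Literature.NumberTheory.Sieve.polyPrimeCount
    exact_mod_cast card_filter_le_add_card_filter himp2 (Finset.range (x + 1))
  -- the value of the limit
  have hΨ : iteratedDeriv k (fun z : ℂ => Λ z *
      cexp ((z - 1) * (Real.log (∏ i, ((f i).natDegree : ℝ)) : ℂ)) *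
        (Complex.Gamma z)⁻¹ ^ k) 0 =
      (((k.factorial : ℝ) * (Literature.NumberTheory.Sieve.batemanHornConst f /
        ∏ i, ((f i).natDegree : ℝ)) : ℝ) : ℂ) := by
    rw [iteratedDeriv_limitFunction_apply_zero hΛ, hΛ0, ← Complex.ofReal_neg,
      ← Complex.ofReal_exp, Real.exp_neg, Real.exp_log hDpos]
    push_cast
    ring
  rw [hΨ] at hT
  -- the family side, for every x
  have hH : ∀ x : ℕ, iteratedDeriv k (fun z : ℂ => (x : ℂ)⁻¹ *
      cexp ((k : ℂ) * (1 - z) * (Real.log (Real.log x) : ℂ)) *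
        ∑ n ∈ Finset.range (x + 1), z ^ (e n)) 0 =
      (x : ℂ)⁻¹ * cexp ((k : ℂ) * (Real.log (Real.log x) : ℂ)) *
        ((k.factorial : ℂ) * (((Finset.range (x + 1)).filter fun n => e n = k).card : ℕ) +
          ∑ n ∈ Finset.range (x + 1), (if e n < k then (k.choose (e n) : ℂ) *
            (e n).factorial * (-((k : ℂ) * (Real.log (Real.log x) : ℂ))) ^ (k - e n)
            else 0)) := fun x => by
    rw [iteratedDeriv_normalisedFamily_apply_zero, sum_extraction_split]
  -- the scale a(x) = (log x)^k / x, in ℂ, for x ≥ 2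
  have hscale : ∀ x : ℕ, 2 ≤ x →
      (x : ℂ)⁻¹ * cexp ((k : ℂ) * (Real.log (Real.log x) : ℂ)) =
        ((Real.log x ^ k / x : ℝ) : ℂ) := by
    intro x hx
    have hlogpos : 0 < Real.log x := Real.log_pos (by exact_mod_cast hx)
    rw [Complex.exp_nat_mul, ← Complex.ofReal_exp, Real.exp_log hlogpos]
    push_cast
    ring
  -- asymptotics of the scale
  have ha : Tendsto (fun x : ℕ => Real.log x ^ k / (x : ℝ)) atTop (𝓝 0) := by
    have := (Real.tendsto_pow_log_div_mul_add_atTop 1 0 k one_ne_zero).comp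
      tendsto_natCast_atTop_atTop
    refine this.congr fun x => ?_
    simp
  have ha2 : Tendsto (fun x : ℕ => Real.log x ^ (2 * k) / (x : ℝ)) atTop (𝓝 0) := by
    have := (Real.tendsto_pow_log_div_mul_add_atTop 1 0 (2 * k) one_ne_zero).comp
      tendsto_natCast_atTop_atTop
    refine this.congr fun x => ?_
    simp
  have ha0 : ∀ x : ℕ, 0 ≤ Real.log x ^ k / (x : ℝ) := fun x =>
    div_nonneg (pow_nonneg (Real.log_natCast_nonneg x) _) (Nat.cast_nonneg x)
  -- the remainder is negligible
  have hR : Tendsto (fun x : ℕ => ((Real.log x ^ k / x : ℝ) : ℂ) *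
      ∑ n ∈ Finset.range (x + 1), (if e n < k then (k.choose (e n) : ℂ) * (e n).factorial *
        (-((k : ℂ) * (Real.log (Real.log x) : ℂ))) ^ (k - e n) else 0)) atTop (𝓝 0) := by
    refine squeeze_zero_norm' ?_
      (by simpa using ha2.const_mul ((n₀ : ℝ) * (k.factorial * ((k : ℝ) + 1) ^ k)))
    filter_upwards [Filter.eventually_ge_atTop 3] with x hx
    obtain ⟨hl1, hll0, hll⟩ := log_facts_of_three_le (x := (x : ℝ)) (by exact_mod_cast hx)
    have hβ : ‖-((k : ℂ) * (Real.log (Real.log x) : ℂ))‖ = k * Real.log (Real.log x) := by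
      rw [norm_neg, norm_mul, Complex.norm_natCast, Complex.norm_real, Real.norm_eq_abs,
        abs_of_nonneg hll0]
    have hmax :
        max 1 ‖-((k : ℂ) * (Real.log (Real.log x) : ℂ))‖ ≤ ((k : ℝ) + 1) * Real.log x := by
      rw [hβ]
      refine max_le ?_ ?_
      · nlinarith
      · nlinarith
    have hrem := norm_sum_extraction_remainder_le k (-((k : ℂ) * (Real.log (Real.log x) : ℂ))) e
      (Finset.range (x + 1)) hge
    rw [norm_mul, Complex.norm_real, Real.norm_eq_abs, abs_of_nonneg (ha0 x)]
    calc Real.log x ^ k / x * ‖∑ n ∈ Finset.range (x + 1), (if e n < k then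
            (k.choose (e n) : ℂ) * (e n).factorial *
              (-((k : ℂ) * (Real.log (Real.log x) : ℂ))) ^ (k - e n) else 0)‖
        ≤ Real.log x ^ k / x * (n₀ * (k.factorial *
            max 1 ‖-((k : ℂ) * (Real.log (Real.log x) : ℂ))‖ ^ k)) :=
          mul_le_mul_of_nonneg_left hrem (ha0 x)
      _ ≤ Real.log x ^ k / x * (n₀ * (k.factorial * (((k : ℝ) + 1) * Real.log x) ^ k)) := by
          gcongr
      _ = (n₀ : ℝ) * (k.factorial * ((k : ℝ) + 1) ^ k) * (Real.log x ^ (2 * k) / x) := by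
          rw [mul_pow]
          ring
  -- the main limit: x⁻¹ (log x)^k π_f(x) → C(f)/D
  have hmain : Tendsto (fun x : ℕ => Real.log x ^ k / (x : ℝ) *
      (Literature.NumberTheory.Sieve.polyPrimeCount f x : ℝ)) atTop
      (𝓝 (Literature.NumberTheory.Sieve.batemanHornConst f /
        ∏ i, ((f i).natDegree : ℝ))) := by
    refine tendsto_mul_of_extraction (c := fun x => ((Finset.range (x + 1)).filter
      fun n => e n = k).card) hT ?_ hR hcp hpc ha ha0
    filter_upwards [Filter.eventually_ge_atTop 2] with x hx
    rw [hH x, hscale x hx]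
  -- conclusion
  unfold Literature.NumberTheory.Sieve.BatemanHornAsymptotic
  refine ⟨Literature.NumberTheory.Sieve.batemanHornConst f, hC, ?_⟩
  simp only [Fintype.card_fin]
  refine Asymptotics.isEquivalent_of_tendsto_one ?_
  have hlim := hmain.mul_const
    ((∏ i, ((f i).natDegree : ℝ)) / Literature.NumberTheory.Sieve.batemanHornConst f)
  rw [show Literature.NumberTheory.Sieve.batemanHornConst f / (∏ i, ((f i).natDegree : ℝ)) *
      ((∏ i, ((f i).natDegree : ℝ)) / Literature.NumberTheory.Sieve.batemanHornConst f) = 1 by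
    field_simp] at hlim
  refine hlim.congr' ?_
  filter_upwards [Filter.eventually_ge_atTop 2] with x hx
  have hx0 : (x : ℝ) ≠ 0 := by positivity
  have hlog : Real.log x ≠ 0 := (Real.log_pos (by exact_mod_cast hx)).ne'
  have hC0 : Literature.NumberTheory.Sieve.batemanHornConst f ≠ 0 := hCpos.ne'
  have hD0 : (∏ i, ((f i).natDegree : ℝ)) ≠ 0 := hDpos.ne'
  simp only [Pi.div_apply]
  field_simp

end Summit.Parity.BatemanHorn.Theorems.AlmostPrimeZerosExtraction
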